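import Summits.QuantumFields.YangMills.Theorems.LuscherReductionOneSiteLevelsValleyAlgebra
import Summits.QuantumFields.YangMills.Theorems.LuscherReductionTwistedTraceScalingTangentChart
import HarnessLib

/-!
# Quaternion bookkeeping for one kinetic step: `vecPart(AB) = a + b + O(|a||b| + |a|²|b| + |b|²|a|)`, four near-identity factors, and a
# near-identity factor times a holonomy
# (lane B of S-BASE, crux `TwistedTraceScaling` stmt-QuantumFields-20203; covariant reformulation of the Laplace step, blueprint §5, brick c1 part ii)

With `…CovariantCurl.hol_mul_eq_transportStep_mul` (`hol_p(W·U) = X_p · hol_p(U)`, `X_p` a product of four near-identity factors whose vector parts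
sum to the covariant curl `(D_U w)_p`), the curvature after a kinetic step is `F_p(W·U) = vecPart(X_p · hol_p(U))`.  This file supplies the
quaternion estimates, componentwise (`|v_c| ≤ …` for each colour `c`): exact identities `vecPart_mul_sub`, `one_sub_scalarPart_mul`; componentwise
bounds for `a × b`, `a·b`, `1 − u₀`; ★ the two-factor step `abs_vecPart_mul_sub_le`; ★ four near-identity factors `abs_vecPart_prod4_sub_sum_le`
(`|vecPart(A₁A₂A₃A₄) − Σaᵢ|_c ≤ 32t²`, `1 − u₀ ≤ 93t²` for `|aᵢ|_c ≤ t ≤ 1/10`); ★ near-identity factor times holonomy `abs_vecPart_step_hol_sub_le`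
(`|vecPart(XH) − F_H − x|_c ≤ ξφ(3ξ + 3φ + 2)`).  Together: `F_p(W·U) = F_p(U) + (D_U w)_p + O(t² + t·|F_p(U)|)`.
HONEST FRAMING: algebra; femto rung R2b1 (stub of a child of a CONDITIONAL route); not a gap, not Clay.
-/

set_option autoImplicit false

noncomputable section

open scoped Matrix BigOperators
open Literature.MathematicalPhysics.QuantumFieldTheory
open Literature.MathematicalPhysics.QuantumLattice

namespace Summit.QuantumFields.YangMills.Theorems.FemtoTransferGap.TwoLattice.Cov

open Summit.QuantumFields.YangMills.Theorems.FemtoTransferGap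
open Summit.QuantumFields.YangMills.Theorems.FemtoTransferGap.TwoLattice

/-! ## §1 Exact identities -/

/-- `vecPart(AB) − a − b = (u₀(A) − 1)·b + (u₀(B) − 1)·a + a × b` (exact). [cite: BrockerTomDieck1985, I (1.10)] -/
theorem vecPart_mul_sub (A B : SU2) :
    vecPart (A * B) - vecPart A - vecPart B =
      (scalarPart A - 1) • vecPart B + (scalarPart B - 1) • vecPart A + vecPart A ⨯₃ vecPart B := by
  rw [vecPart_mul]
  funext c
  simp only [Pi.add_apply, Pi.sub_apply, Pi.smul_apply, smul_eq_mul]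
  ring

/-- `1 − u₀(AB) = (1 − u₀(A)) + (1 − u₀(B)) − (1 − u₀(A))(1 − u₀(B)) + a·b` (exact). [cite: BrockerTomDieck1985, I (1.10)] -/
theorem one_sub_scalarPart_mul (A B : SU2) :
    1 - scalarPart (A * B) =
      (1 - scalarPart A) + (1 - scalarPart B) - (1 - scalarPart A) * (1 - scalarPart B) + vecPart A ⬝ᵥ vecPart B := by
  rw [scalarPart_mul]; ring

/-! ## §2 Componentwise bounds -/

/-- `|(a × b)_c| ≤ 2αβ` when `|a_i| ≤ α`, `|b_i| ≤ β`. [folklore] -/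
theorem abs_cross_apply_le {a b : Fin 3 → ℝ} {α β : ℝ} (ha : ∀ i, |a i| ≤ α) (hb : ∀ i, |b i| ≤ β) (c : Fin 3) :
    |(a ⨯₃ b) c| ≤ 2 * α * β := by
  have hα : 0 ≤ α := (abs_nonneg _).trans (ha 0)
  have key : ∀ i j k l : Fin 3, |a i * b j - a k * b l| ≤ 2 * α * β := fun i j k l => by
    have h1 : |a i * b j| ≤ α * β := by rw [abs_mul]; exact mul_le_mul (ha i) (hb j) (abs_nonneg _) hα
    have h2 : |a k * b l| ≤ α * β := by rw [abs_mul]; exact mul_le_mul (ha k) (hb l) (abs_nonneg _) hα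
    have := abs_sub (a i * b j) (a k * b l)
    linarith
  rw [cross_apply]
  fin_cases c
  · exact key 1 2 2 1
  · exact key 2 0 0 2
  · exact key 0 1 1 0

/-- `|a·b| ≤ 3αβ`. [folklore] -/
theorem abs_dot_le {a b : Fin 3 → ℝ} {α β : ℝ} (ha : ∀ i, |a i| ≤ α) (hb : ∀ i, |b i| ≤ β) : |a ⬝ᵥ b| ≤ 3 * α * β := by
  have hα : 0 ≤ α := (abs_nonneg _).trans (ha 0)
  have h : ∀ i, |a i * b i| ≤ α * β := fun i => by rw [abs_mul]; exact mul_le_mul (ha i) (hb i) (abs_nonneg _) hα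
  simp only [dotProduct, Fin.sum_univ_three]
  have := abs_add_le (a 0 * b 0 + a 1 * b 1) (a 2 * b 2)
  have := abs_add_le (a 0 * b 0) (a 1 * b 1)
  linarith [h 0, h 1, h 2]

/-- `0 ≤ 1 − u₀(A) ≤ 3α²` on the hemisphere `u₀ ≥ 0` when `|a_i| ≤ α`. [folklore] -/
theorem one_sub_scalarPart_le_of_abs_le {A : SU2} (hA : 0 ≤ scalarPart A) {α : ℝ} (ha : ∀ i, |vecPart A i| ≤ α) :
    0 ≤ 1 - scalarPart A ∧ 1 - scalarPart A ≤ 3 * α ^ 2 := by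
  obtain ⟨h0, h1⟩ := Chart.one_sub_scalarPart_le A hA
  refine ⟨h0, h1.trans ?_⟩
  have h : ∀ i, vecPart A i ^ 2 ≤ α ^ 2 := fun i => by
    rw [← sq_abs]; exact pow_le_pow_left₀ (abs_nonneg _) (ha i) 2
  simp only [Fin.sum_univ_three]
  linarith [h 0, h 1, h 2]

/-- `|a_c| ≤ 1` always (`u₀² + |a|² = 1`). [folklore] -/
theorem abs_vecPart_le_one (A : SU2) (c : Fin 3) : |vecPart A c| ≤ 1 := by
  have h := scalarPart_sq_add A
  have hc : vecPart A c ^ 2 ≤ ∑ a, vecPart A a ^ 2 := Finset.single_le_sum (fun a _ => sq_nonneg (vecPart A a)) (Finset.mem_univ c)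
  rw [abs_le]; constructor <;> nlinarith [sq_nonneg (scalarPart A)]

/-! ## §3 The two-factor step -/

/-- ★ **Two near-identity factors**: `u₀(A), u₀(B) ≥ 0`, `|a_i| ≤ α`, `|b_i| ≤ β` ⇒ for every colour `c`,
`|vecPart(AB)_c − a_c − b_c| ≤ 3α²β + 3β²α + 2αβ`, and `1 − u₀(AB) ≤ 3α² + 3β² + 3αβ`. [cite: BrockerTomDieck1985, I (1.10)] -/
theorem abs_vecPart_mul_sub_le {A B : SU2} (hA : 0 ≤ scalarPart A) (hB : 0 ≤ scalarPart B) {α β : ℝ}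
    (ha : ∀ i, |vecPart A i| ≤ α) (hb : ∀ i, |vecPart B i| ≤ β) :
    (∀ c, |vecPart (A * B) c - vecPart A c - vecPart B c| ≤ 3 * α ^ 2 * β + 3 * β ^ 2 * α + 2 * α * β) ∧
      1 - scalarPart (A * B) ≤ 3 * α ^ 2 + 3 * β ^ 2 + 3 * α * β := by
  have hα : 0 ≤ α := (abs_nonneg _).trans (ha 0)
  have hβ : 0 ≤ β := (abs_nonneg _).trans (hb 0)
  obtain ⟨hA0, hA1⟩ := one_sub_scalarPart_le_of_abs_le hA ha
  obtain ⟨hB0, hB1⟩ := one_sub_scalarPart_le_of_abs_le hB hb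
  constructor
  · intro c
    have h := congrFun (vecPart_mul_sub A B) c
    simp only [Pi.sub_apply, Pi.add_apply, Pi.smul_apply, smul_eq_mul] at h
    rw [h]
    have h1 : |(scalarPart A - 1) * vecPart B c| ≤ 3 * α ^ 2 * β := by
      rw [abs_mul, abs_sub_comm, abs_of_nonneg hA0]
      exact mul_le_mul hA1 (hb c) (abs_nonneg _) (by positivity)
    have h2 : |(scalarPart B - 1) * vecPart A c| ≤ 3 * β ^ 2 * α := by
      rw [abs_mul, abs_sub_comm, abs_of_nonneg hB0]
      exact mul_le_mul hB1 (ha c) (abs_nonneg _) (by positivity)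
    have h3 := abs_cross_apply_le ha hb c
    have := abs_add_le ((scalarPart A - 1) * vecPart B c + (scalarPart B - 1) * vecPart A c) ((vecPart A ⨯₃ vecPart B) c)
    have := abs_add_le ((scalarPart A - 1) * vecPart B c) ((scalarPart B - 1) * vecPart A c)
    linarith
  · rw [one_sub_scalarPart_mul]
    have h3 := (abs_le.mp (abs_dot_le ha hb)).2
    nlinarith [mul_nonneg hA0 hB0]

/-- Size of the product's vector part: `|vecPart(AB)_c| ≤ α + β + (3α²β + 3β²α + 2αβ)`. [folklore] -/
theorem abs_vecPart_mul_le {A B : SU2} (hA : 0 ≤ scalarPart A) (hB : 0 ≤ scalarPart B) {α β : ℝ}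
    (ha : ∀ i, |vecPart A i| ≤ α) (hb : ∀ i, |vecPart B i| ≤ β) (c : Fin 3) :
    |vecPart (A * B) c| ≤ α + β + (3 * α ^ 2 * β + 3 * β ^ 2 * α + 2 * α * β) := by
  have h := (abs_vecPart_mul_sub_le hA hB ha hb).1 c
  have e : vecPart (A * B) c = (vecPart (A * B) c - vecPart A c - vecPart B c) + vecPart A c + vecPart B c := by ring
  rw [e]
  have := abs_add_le ((vecPart (A * B) c - vecPart A c - vecPart B c) + vecPart A c) (vecPart B c)
  have := abs_add_le (vecPart (A * B) c - vecPart A c - vecPart B c) (vecPart A c)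
  linarith [ha c, hb c]

/-- Hemisphere is kept: `1 − u₀(AB) ≤ 3α² + 3β² + 3αβ ≤ 1 ⇒ u₀(AB) ≥ 0`. [folklore] -/
theorem scalarPart_mul_nonneg {A B : SU2} (hA : 0 ≤ scalarPart A) (hB : 0 ≤ scalarPart B) {α β : ℝ}
    (ha : ∀ i, |vecPart A i| ≤ α) (hb : ∀ i, |vecPart B i| ≤ β) (h : 3 * α ^ 2 + 3 * β ^ 2 + 3 * α * β ≤ 1) :
    0 ≤ scalarPart (A * B) := by
  have := (abs_vecPart_mul_sub_le hA hB ha hb).2; linarith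

/-! ## §4 Four near-identity factors -/

/-- ★ **Four near-identity factors** (the transported step `X_p`): if `u₀(Aᵢ) ≥ 0` and `|vecPart(Aᵢ)_c| ≤ t ≤ 1/10` for `i = 1..4`, then for
every colour `c`: `|vecPart(A₁A₂A₃A₄)_c − Σᵢ vecPart(Aᵢ)_c| ≤ 32t²`, `|vecPart(A₁A₂A₃A₄)_c| ≤ 8t`, and `0 ≤ u₀(A₁A₂A₃A₄)`, `1 − u₀ ≤ 93t²`.
[cite: BrockerTomDieck1985, I (1.10)] -/
theorem abs_vecPart_prod4_sub_sum_le {A₁ A₂ A₃ A₄ : SU2} (h₁ : 0 ≤ scalarPart A₁) (h₂ : 0 ≤ scalarPart A₂) (h₃ : 0 ≤ scalarPart A₃)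
    (h₄ : 0 ≤ scalarPart A₄) {t : ℝ} (ht : t ≤ 1 / 10) (ha₁ : ∀ i, |vecPart A₁ i| ≤ t) (ha₂ : ∀ i, |vecPart A₂ i| ≤ t)
    (ha₃ : ∀ i, |vecPart A₃ i| ≤ t) (ha₄ : ∀ i, |vecPart A₄ i| ≤ t) :
    (∀ c, |vecPart (A₁ * (A₂ * (A₃ * A₄))) c - (vecPart A₁ c + vecPart A₂ c + vecPart A₃ c + vecPart A₄ c)| ≤ 32 * t ^ 2) ∧
      (∀ c, |vecPart (A₁ * (A₂ * (A₃ * A₄))) c| ≤ 8 * t) ∧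
      0 ≤ scalarPart (A₁ * (A₂ * (A₃ * A₄))) ∧ 1 - scalarPart (A₁ * (A₂ * (A₃ * A₄))) ≤ 93 * t ^ 2 := by
  have ht0 : 0 ≤ t := (abs_nonneg _).trans (ha₁ 0)
  have k1 : t * t ≤ t / 10 := by nlinarith
  have k2 : t * t * t ≤ t * t / 10 := by nlinarith
  -- step 1: B₁ = A₃A₄
  obtain ⟨d1, s1⟩ := abs_vecPart_mul_sub_le h₃ h₄ ha₃ ha₄
  have b1 : ∀ c, |vecPart (A₃ * A₄) c| ≤ 3 * t := fun c => by
    have := abs_vecPart_mul_le h₃ h₄ ha₃ ha₄ c; nlinarith [k1, k2]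
  have s1' : 0 ≤ scalarPart (A₃ * A₄) := by nlinarith [k1]
  -- step 2: B₂ = A₂B₁
  obtain ⟨d2, s2⟩ := abs_vecPart_mul_sub_le h₂ s1' ha₂ b1
  have b2 : ∀ c, |vecPart (A₂ * (A₃ * A₄)) c| ≤ 5 * t := fun c => by
    have := abs_vecPart_mul_le h₂ s1' ha₂ b1 c; nlinarith [k1, k2]
  have s2' : 0 ≤ scalarPart (A₂ * (A₃ * A₄)) := by nlinarith [k1]
  -- step 3: X = A₁B₂
  obtain ⟨d3, s3⟩ := abs_vecPart_mul_sub_le h₁ s2' ha₁ b2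
  have b3 : ∀ c, |vecPart (A₁ * (A₂ * (A₃ * A₄))) c| ≤ 8 * t := fun c => by
    have := abs_vecPart_mul_le h₁ s2' ha₁ b2 c; nlinarith [k1, k2]
  refine ⟨fun c => ?_, b3, by nlinarith [k1], by nlinarith [k1]⟩
  have e : vecPart (A₁ * (A₂ * (A₃ * A₄))) c - (vecPart A₁ c + vecPart A₂ c + vecPart A₃ c + vecPart A₄ c) =
      (vecPart (A₁ * (A₂ * (A₃ * A₄))) c - vecPart A₁ c - vecPart (A₂ * (A₃ * A₄)) c) +
        (vecPart (A₂ * (A₃ * A₄)) c - vecPart A₂ c - vecPart (A₃ * A₄) c) +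
        (vecPart (A₃ * A₄) c - vecPart A₃ c - vecPart A₄ c) := by ring
  rw [e]
  have t1 := abs_add_le ((vecPart (A₁ * (A₂ * (A₃ * A₄))) c - vecPart A₁ c - vecPart (A₂ * (A₃ * A₄)) c) +
    (vecPart (A₂ * (A₃ * A₄)) c - vecPart A₂ c - vecPart (A₃ * A₄) c)) (vecPart (A₃ * A₄) c - vecPart A₃ c - vecPart A₄ c)
  have t2 := abs_add_le (vecPart (A₁ * (A₂ * (A₃ * A₄))) c - vecPart A₁ c - vecPart (A₂ * (A₃ * A₄)) c)
    (vecPart (A₂ * (A₃ * A₄)) c - vecPart A₂ c - vecPart (A₃ * A₄) c)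
  nlinarith [d1 c, d2 c, d3 c, k1, k2]

/-! ## §5 A near-identity factor times a holonomy -/

/-- ★ **Step times holonomy**: `u₀(X), u₀(H) ≥ 0`, `|x_i| ≤ ξ`, `|F_H,i| ≤ φ` ⇒ `|vecPart(XH)_c − F_{H,c} − x_c| ≤ 3ξ²φ + 3φ²ξ + 2ξφ` for every
colour — the curvature after the step is `F_H + x` up to `O(ξ² + ξφ)` when `φ ≤ 1`. [cite: BrockerTomDieck1985, I (1.10)] [cite: Luscher1983, §3] -/
theorem abs_vecPart_step_hol_sub_le {X H : SU2} (hX : 0 ≤ scalarPart X) (hH : 0 ≤ scalarPart H) {ξ φ : ℝ}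
    (hx : ∀ i, |vecPart X i| ≤ ξ) (hF : ∀ i, |vecPart H i| ≤ φ) (c : Fin 3) :
    |vecPart (X * H) c - vecPart H c - vecPart X c| ≤ 3 * ξ ^ 2 * φ + 3 * φ ^ 2 * ξ + 2 * ξ * φ := by
  have h := (abs_vecPart_mul_sub_le hX hH hx hF).1 c
  have e : vecPart (X * H) c - vecPart H c - vecPart X c = vecPart (X * H) c - vecPart X c - vecPart H c := by ring
  rw [e]; exact h

end Summit.QuantumFields.YangMills.Theorems.FemtoTransferGap.TwoLattice.Cov

end
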